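import Mathlib
import Literature.NumberTheory.LFunctions.Zhang2022.SkeletonPartThree
import Literature.NumberTheory.LFunctions.Zhang2022.Section3Lemma31
import Literature.NumberTheory.LFunctions.Zhang2022.Section4Eq410Edge
import Literature.NumberTheory.LFunctions.Zhang2022.TypedSection01and02B
import Literature.NumberTheory.LFunctions.Zhang2022.TypedSection08B
import HarnessLib

/-!
# Zhang (2022) §15 p. 88 / §16 p. 95, "direct calculation" of the residue products — I: parameter sizes

Topic `Literature/NumberTheory/LFunctions/Zhang2022` (Landau–Siegel audit tree; verdict-neutral).
Y. Zhang, *Discrete mean estimates and the Landau–Siegel zero*, arXiv:2211.02515v1 (2022)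
[Zhang2022LandauSiegel] — **an unrefereed manuscript under adjudication** (cell siegel-zhang, D-0069
width campaign). DISCHARGE file (theorems only; no new definitions, no new facts); no statement about
Theorems 1–2 of the manuscript or about Landau–Siegel zeros is made or implied.

This first file collects the SIZES of the §2 parameters that the "direct calculation" steps
`Z22:§15.u060`–`u062` [Z22 p.88, tex L4385–L4392] and `Z22:§16.u044` [Z22 p.95, tex L4678–L4681] use:
`α = π/𝓛⁹` (2.10), `log P₄ = 𝓛⁹ − 2𝓛^{1.1} + 519 log 𝓛` (`P₄ = PT⁻²t₀`, §6 p. 12), hence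
`|α log P₄ − π| ≤ 521π/𝓛`; `|c′α𝓛| ≤ |c′|π/𝓛`; the index convention `β₄ = β₁, β₅ = β₂` (§8 p. 17);
`|β₁| ≤ 2α`, `|β₂| ≤ 4α`, `|P₄^{βₖ−βⱼ}| = 1`; and the two sizes of `L′(1,χ)` that control the cross
terms: `|L′(1,χ)| ≥ c > 0` under (A) (Lemma 5.7 — a THEOREM of the tree, `Skeleton.lemma57_holds`)
and `|L′(1,χ)| ≤ 2e^{9/2}(1+𝓛)𝓛` (tree `Lemma31.norm_deriv_LFunction_le_near_one`). Companions:
`Section15ResidueMainTerms` (the identities `β₁β₂P₄^{β₃−βⱼ}/((β_{j+1}−βⱼ)(β_{j+2}−βⱼ)) → 1, 2, 1`)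
and `Section15ResidueProducts` (the edges themselves).
-/

noncomputable section

open Complex Real Filter Topology

namespace Literature.NumberTheory.LFunctions.Zhang2022.ResidueValues

open Skeleton

/-! ## The parameters at a large modulus -/

section Parameters

variable {D : ℕ}

-- `α = π/𝓛⁹` is the tree's `Section2.alpha_eq_pi_div_ell9` (TypedSection01and02B); `𝓛 ≥ 3` for
-- `D ≥ ⌈e³⌉` is `Skeleton.three_le_ell_of_le` (Section4Eq410Edge); `Re βⱼ = 0` is `Typed.S8B.betaJ_re`
-- (TypedSection08B) — cited, not restated.

/-- `α > 0` for `𝓛 ≥ 3`. [cite: Zhang2022LandauSiegel, §2 (2.10)] -/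
theorem alpha_pos (hL : 3 ≤ ell D) : 0 < alpha D := by
  rw [Section2.alpha_eq_pi_div_ell9]; positivity

/-- `α ≤ π/𝓛` for `𝓛 ≥ 3` (crude). [cite: Zhang2022LandauSiegel, §2 (2.10)] -/
theorem alpha_le (hL : 3 ≤ ell D) : alpha D ≤ π / ell D := by
  rw [Section2.alpha_eq_pi_div_ell9]
  have h1 : (1 : ℝ) ≤ ell D := by linarith
  have h9 : ell D ≤ ell D ^ 9 := by
    calc ell D = ell D ^ 1 := (pow_one _).symm
      _ ≤ ell D ^ 9 := pow_le_pow_right₀ h1 (by norm_num)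
  exact div_le_div_of_nonneg_left Real.pi_pos.le (by linarith) h9

/-- `α ≤ 1` for `𝓛 ≥ 3`. [cite: Zhang2022LandauSiegel, §2 (2.10)] -/
theorem alpha_le_one (hL : 3 ≤ ell D) : alpha D ≤ 1 := by
  rw [Section2.alpha_eq_pi_div_ell9, div_le_one (by positivity)]
  have h1 : (3 : ℝ) ^ 9 ≤ ell D ^ 9 := pow_le_pow_left₀ (by norm_num) hL 9
  nlinarith [Real.pi_lt_four]

/-- `P₄ = PT⁻²t₀ > 0` for `𝓛 ≥ 3`. [cite: Zhang2022LandauSiegel, §6 p. 12] -/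
theorem P4_pos (hL : 3 ≤ ell D) : 0 < P4 D := by
  have ht : 0 < t0 D := by rw [t0]; positivity
  rw [P4, bigP, bigT]
  positivity

/-- `log P₄ = 𝓛⁹ − 2𝓛^{1.1} + 519 log 𝓛`. [cite: Zhang2022LandauSiegel, §6 p. 12] -/
theorem log_P4_eq (hL : 3 ≤ ell D) :
    Real.log (P4 D) = ell D ^ 9 - 2 * ell D ^ (1.1 : ℝ) + 519 * Real.log (ell D) := by
  have hℓ : 0 < ell D := by linarith
  have hP : 0 < bigP D := Real.exp_pos _
  have hT : 0 < bigT D := Real.exp_pos _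
  have ht : 0 < t0 D := by rw [t0]; positivity
  rw [P4, Real.log_mul (div_pos hP (pow_pos hT 2)).ne' ht.ne', Real.log_div hP.ne' (pow_ne_zero _ hT.ne'),
    Real.log_pow, bigP, bigT, Real.log_exp, Real.log_exp, t0, Real.log_pow]
  push_cast
  ring

/-- **`α log P₄ = π + O(1/𝓛)`**: `|α log P₄ − π| ≤ 521π/𝓛` for `𝓛 ≥ 3` (in fact `O(𝓛^{−7.9})`).
[cite: Zhang2022LandauSiegel, §2 (2.10), §6 p. 12] -/
theorem abs_alpha_mul_log_P4_sub_pi_le (hL : 3 ≤ ell D) :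
    |alpha D * Real.log (P4 D) - π| ≤ 521 * π / ell D := by
  have hℓ : 0 < ell D := by linarith
  have h1 : (1 : ℝ) ≤ ell D := by linarith
  rw [log_P4_eq hL, Section2.alpha_eq_pi_div_ell9]
  have h9 : ell D ^ 9 ≠ 0 := pow_ne_zero _ hℓ.ne'
  have hexpr : π / ell D ^ 9 * (ell D ^ 9 - 2 * ell D ^ (1.1 : ℝ) + 519 * Real.log (ell D)) - π =
      π * (-2 * ell D ^ (1.1 : ℝ) + 519 * Real.log (ell D)) / ell D ^ 9 := by
    field_simp
    ring
  rw [hexpr]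
  -- `ℓ^{1.1} ≤ ℓ^8` and `0 ≤ log ℓ ≤ ℓ ≤ ℓ^8`
  have hr : ell D ^ (1.1 : ℝ) ≤ ell D ^ 8 := by
    calc ell D ^ (1.1 : ℝ) ≤ ell D ^ (8 : ℝ) := Real.rpow_le_rpow_of_exponent_le h1 (by norm_num)
      _ = ell D ^ 8 := by norm_cast
  have hr0 : 0 ≤ ell D ^ (1.1 : ℝ) := Real.rpow_nonneg hℓ.le _
  have hlog0 : 0 ≤ Real.log (ell D) := Real.log_nonneg h1
  have hlog : Real.log (ell D) ≤ ell D ^ 8 := by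
    calc Real.log (ell D) ≤ ell D := (Real.log_le_sub_one_of_pos hℓ).trans (by linarith)
      _ = ell D ^ 1 := (pow_one _).symm
      _ ≤ ell D ^ 8 := pow_le_pow_right₀ h1 (by norm_num)
  have hnum : |π * (-2 * ell D ^ (1.1 : ℝ) + 519 * Real.log (ell D))| ≤ π * (521 * ell D ^ 8) := by
    rw [abs_mul, abs_of_pos Real.pi_pos]
    refine mul_le_mul_of_nonneg_left ?_ Real.pi_pos.le
    refine abs_le.mpr ⟨?_, ?_⟩ <;> nlinarith
  rw [abs_div, abs_of_pos (pow_pos hℓ 9)]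
  calc |π * (-2 * ell D ^ (1.1 : ℝ) + 519 * Real.log (ell D))| / ell D ^ 9
      ≤ π * (521 * ell D ^ 8) / ell D ^ 9 := by gcongr
    _ = 521 * π / ell D := by field_simp

/-- `|c′α𝓛| ≤ |c′|π/𝓛` for `𝓛 ≥ 3` (in fact `= |c′|π𝓛⁻⁸`). [cite: Zhang2022LandauSiegel, §2 (2.13)] -/
theorem abs_e_le (c' : ℝ) (hL : 3 ≤ ell D) : |c' * alpha D * ell D| ≤ |c'| * π / ell D := by
  have hℓ : 0 < ell D := by linarith
  have h1 : (1 : ℝ) ≤ ell D := by linarith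
  rw [Section2.alpha_eq_pi_div_ell9, abs_mul, abs_mul, abs_of_pos hℓ, abs_div, abs_of_pos Real.pi_pos,
    abs_of_pos (pow_pos hℓ 9)]
  have h8 : ell D ^ 2 ≤ ell D ^ 9 := pow_le_pow_right₀ h1 (by norm_num)
  rw [mul_div_assoc, mul_assoc]
  refine mul_le_mul_of_nonneg_left ?_ (abs_nonneg _)
  rw [div_mul_eq_mul_div, div_le_div_iff₀ (pow_pos hℓ 9) hℓ]
  nlinarith [Real.pi_pos]

/-- The index convention of §8: `β_{j}` for `j = 1, …, 5`. [cite: Zhang2022LandauSiegel, §8 p. 17] -/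
theorem betaJ_one (c' : ℝ) (D : ℕ) : betaJ c' D 1 = beta1 c' D := by simp [betaJ]

/-- `β₂`. [cite: Zhang2022LandauSiegel, §8 p. 17] -/
theorem betaJ_two (c' : ℝ) (D : ℕ) : betaJ c' D 2 = beta2 c' D := by simp [betaJ]

/-- `β₃`. [cite: Zhang2022LandauSiegel, §8 p. 17] -/
theorem betaJ_three (c' : ℝ) (D : ℕ) : betaJ c' D 3 = beta3 c' D := by simp [betaJ]

/-- `β₄ = β₁`. [cite: Zhang2022LandauSiegel, §8 p. 17] -/
theorem betaJ_four (c' : ℝ) (D : ℕ) : betaJ c' D 4 = beta1 c' D := by simp [betaJ]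

/-- `β₅ = β₂`. [cite: Zhang2022LandauSiegel, §8 p. 17] -/
theorem betaJ_five (c' : ℝ) (D : ℕ) : betaJ c' D 5 = beta2 c' D := by simp [betaJ]

/-- A positive real base to a purely imaginary power: `x^{it} = e^{it log x}` (the form in which
`P₄^{β₃−βⱼ}` is evaluated in the "direct calculation"). [cite: Zhang2022LandauSiegel, §15 p. 88] -/
theorem ofReal_cpow_I_mul {x : ℝ} (hx : 0 < x) (t : ℝ) :
    ((x : ℂ)) ^ (I * (t : ℂ)) = Complex.exp (I * ((t * Real.log x : ℝ) : ℂ)) := by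
  rw [Complex.cpow_def_of_ne_zero (Complex.ofReal_ne_zero.mpr hx.ne'), ← Complex.ofReal_log hx.le]
  push_cast
  ring_nf

end Parameters

/-! ## The shifts in the form `β₁ = iα(1−5e)`, `β₂ = 2iα(1+e)`, `β₃ = 3iα(1−e)`, `e = c′α𝓛` -/

section Shifts

variable (c' : ℝ)

/-- The shorthand `e = c′α𝓛` (so `β₁ = iα(1−5e)`, `β₂ = 2iα(1+e)`, `β₃ = 3iα(1−e)`).
[cite: Zhang2022LandauSiegel, §2 (2.13)] -/
theorem beta1_eq (D : ℕ) :
    beta1 c' D = I * ((alpha D * (1 - 5 * (c' * alpha D * ell D)) : ℝ) : ℂ) := by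
  rw [beta1]; push_cast; ring

/-- `β₂ = 2iα(1+e)`. [cite: Zhang2022LandauSiegel, §2 (2.13)] -/
theorem beta2_eq (D : ℕ) :
    beta2 c' D = I * ((alpha D * (2 + 2 * (c' * alpha D * ell D)) : ℝ) : ℂ) := by
  rw [beta2]; push_cast; ring

/-- `β₃ = 3iα(1−e)`. [cite: Zhang2022LandauSiegel, §2 (2.13)] -/
theorem beta3_eq (D : ℕ) :
    beta3 c' D = I * ((alpha D * (3 - 3 * (c' * alpha D * ell D)) : ℝ) : ℂ) := by
  rw [beta3]; push_cast; ring

end Shifts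

/-! ## Sizes: `|β_j| ≍ α`, `|β_j − β_k| ≍ α`, `|P₄^{β₃−βⱼ}| = 1`, `1 ≪ |L′(1,χ)| ≪ 𝓛²` -/

section Sizes

variable (c' : ℝ) {D : ℕ}

/-- `|P₄^{βₖ−βⱼ}| = 1` (`P₄ > 0`, purely imaginary exponent). [cite: Zhang2022LandauSiegel, §15 p. 88] -/
theorem norm_P4_cpow_betaJ_sub (hL : 3 ≤ ell D) (j k : ℕ) :
    ‖((P4 D : ℝ) : ℂ) ^ (betaJ c' D k - betaJ c' D j)‖ = 1 := by
  rw [Complex.norm_cpow_eq_rpow_re_of_pos (P4_pos hL), Complex.sub_re, Typed.S8B.betaJ_re, Typed.S8B.betaJ_re,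
    sub_zero, Real.rpow_zero]

/-- `|β₁| ≤ 2α` when `|e| ≤ 1/14`. [cite: Zhang2022LandauSiegel, §2 (2.13)] -/
theorem norm_beta1_le (hL : 3 ≤ ell D) (he : |c' * alpha D * ell D| ≤ 1 / 14) :
    ‖beta1 c' D‖ ≤ 2 * alpha D := by
  have hα := alpha_pos hL
  have he' := abs_le.mp he
  rw [beta1_eq, norm_mul, Complex.norm_I, one_mul, Complex.norm_real, Real.norm_eq_abs,
    abs_mul, abs_of_pos hα]
  have habs : |1 - 5 * (c' * alpha D * ell D)| ≤ 2 := abs_le.mpr ⟨by linarith, by linarith⟩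
  nlinarith

/-- `|β₂| ≤ 4α` when `|e| ≤ 1/14`. [cite: Zhang2022LandauSiegel, §2 (2.13)] -/
theorem norm_beta2_le (hL : 3 ≤ ell D) (he : |c' * alpha D * ell D| ≤ 1 / 14) :
    ‖beta2 c' D‖ ≤ 4 * alpha D := by
  have hα := alpha_pos hL
  have he' := abs_le.mp he
  rw [beta2_eq, norm_mul, Complex.norm_I, one_mul, Complex.norm_real, Real.norm_eq_abs,
    abs_mul, abs_of_pos hα]
  have habs : |2 + 2 * (c' * alpha D * ell D)| ≤ 4 := abs_le.mpr ⟨by linarith, by linarith⟩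
  nlinarith

/-- A generic lower bound: `|iα·r| ≥ α/2` whenever `|r| ≥ 1/2` (used for `|β_{j+1} − βⱼ| ≫ α`).
[cite: Zhang2022LandauSiegel, §15 p. 88] -/
theorem norm_I_mul_ofReal_ge {a r : ℝ} (ha : 0 < a) (hr : 1 / 2 ≤ |r|) :
    a / 2 ≤ ‖I * ((a * r : ℝ) : ℂ)‖ := by
  rw [norm_mul, Complex.norm_I, one_mul, Complex.norm_real, Real.norm_eq_abs, abs_mul,
    abs_of_pos ha]
  nlinarith

/-- **`|L′(1,χ)| ≥ c₅₇ > 0` under (A)** (Lemma 5.7, a theorem of the tree: `L′(1,χ) ≫ D/φ(D) ≥ 1`).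
[cite: Zhang2022LandauSiegel, §5 Lemma 5.7] -/
theorem norm_deriv_LFunction_one_ge :
    ∃ c : ℝ, 0 < c ∧ ForAllLarge fun D _ χ => AssumptionA D χ → c ≤ ‖deriv χ.LFunction 1‖ := by
  obtain ⟨c, hc, D₀, h⟩ := lemma57_holds
  refine ⟨c, hc, max D₀ 1, fun D _ χ hD hq hp hA => ?_⟩
  have hD₀ : D₀ ≤ D := le_trans (le_max_left _ _) hD
  have hD1 : 1 ≤ D := le_trans (le_max_right _ _) hD
  have h1 := h D χ hD₀ hq hp hA
  have hφpos : (0 : ℝ) < Nat.totient D := by exact_mod_cast Nat.totient_pos.mpr hD1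
  have hφle : (Nat.totient D : ℝ) ≤ D := by exact_mod_cast Nat.totient_le D
  have hrat : (1 : ℝ) ≤ (D : ℝ) / Nat.totient D := by rw [le_div_iff₀ hφpos]; linarith
  calc c = c * 1 := (mul_one c).symm
    _ ≤ c * ((D : ℝ) / Nat.totient D) := by gcongr
    _ ≤ (deriv χ.LFunction 1).re := h1
    _ ≤ ‖deriv χ.LFunction 1‖ := Complex.re_le_norm _

/-- **`|L′(1,χ)| ≤ 2e^{9/2}(1+𝓛)𝓛`** for `χ` primitive, `𝓛 ≥ 3` (tree: Cauchy's estimate,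
`Lemma31.norm_deriv_LFunction_le_near_one`). [cite: Zhang2022LandauSiegel, §2 (2.31)] -/
theorem norm_deriv_LFunction_one_le [NeZero D] (χ : DirichletCharacter ℂ D) (hL : 3 ≤ ell D)
    (hp : χ.IsPrimitive) :
    ‖deriv χ.LFunction 1‖ ≤ 2 * Real.exp (9 / 2) * (1 + ell D) * ell D := by
  have hL' : 3 ≤ Real.log D := hL
  exact Lemma31.norm_deriv_LFunction_le_near_one χ hL' hp (w := 1)
    (by rw [sub_self, norm_zero]; positivity)

/-- The four-term product estimate behind "by direct calculation": from `R = m + O(ε₁)`,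
`R′ = M + O(ε₂)`, `|m| ≤ A`, `|M| ≤ B`, `mM = v + O(δ)` conclude `RR′ = v + O(ε₁ε₂ + ε₁B + Aε₂ + δ)`.
[cite: Zhang2022LandauSiegel, §15 p. 88] -/
theorem norm_mul_sub_le_of_approx {R R' m M v : ℂ} {ε₁ ε₂ A B δ : ℝ} (h1 : ‖R - m‖ ≤ ε₁)
    (h2 : ‖R' - M‖ ≤ ε₂) (hA : ‖m‖ ≤ A) (hB : ‖M‖ ≤ B) (hδ : ‖m * M - v‖ ≤ δ) :
    ‖R * R' - v‖ ≤ ε₁ * ε₂ + ε₁ * B + A * ε₂ + δ := by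
  have e1 : 0 ≤ ε₁ := (norm_nonneg _).trans h1
  have a0 : 0 ≤ A := (norm_nonneg _).trans hA
  have hsplit : R * R' - v =
      (R - m) * (R' - M) + (R - m) * M + m * (R' - M) + (m * M - v) := by ring
  rw [hsplit]
  have t1 : ‖(R - m) * (R' - M)‖ ≤ ε₁ * ε₂ := by
    rw [norm_mul]; exact mul_le_mul h1 h2 (norm_nonneg _) e1
  have t2 : ‖(R - m) * M‖ ≤ ε₁ * B := by
    rw [norm_mul]; exact mul_le_mul h1 hB (norm_nonneg _) e1
  have t3 : ‖m * (R' - M)‖ ≤ A * ε₂ := by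
    rw [norm_mul]; exact mul_le_mul hA h2 (norm_nonneg _) a0
  calc ‖(R - m) * (R' - M) + (R - m) * M + m * (R' - M) + (m * M - v)‖
      ≤ ‖(R - m) * (R' - M)‖ + ‖(R - m) * M‖ + ‖m * (R' - M)‖ + ‖m * M - v‖ := by
        refine (norm_add_le _ _).trans ?_
        refine add_le_add ((norm_add_le _ _).trans (add_le_add (norm_add_le _ _) le_rfl)) le_rfl
    _ ≤ ε₁ * ε₂ + ε₁ * B + A * ε₂ + δ := by linarith

end Sizes

/-! ## Thresholds and the main-term error budget -/

section Thresholds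

variable (c' : ℝ)

/-- The eventual smallness of `e = c′α𝓛` and `𝓛 ≥ 3`: both hold once
`D ≥ max ⌈e³⌉ ⌈e^{14|c′|π}⌉`. [cite: Zhang2022LandauSiegel, §2 (2.13)] -/
theorem thresholds {D : ℕ} (hD : max ⌈Real.exp 3⌉₊ ⌈Real.exp (14 * |c'| * π)⌉₊ ≤ D) :
    3 ≤ ell D ∧ |c' * alpha D * ell D| ≤ 1 / 14 := by
  have hL : 3 ≤ ell D := three_le_ell_of_le (le_trans (le_max_left _ _) hD)
  refine ⟨hL, ?_⟩
  have hℓ : 0 < ell D := by linarith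
  have h14 : 14 * |c'| * π ≤ ell D := by
    have h : Real.exp (14 * |c'| * π) ≤ D :=
      le_trans (Nat.le_ceil _) (by exact_mod_cast le_trans (le_max_right _ _) hD)
    exact (Real.le_log_iff_exp_le (lt_of_lt_of_le (Real.exp_pos _) h)).mpr h
  refine (abs_e_le c' hL).trans ?_
  rw [div_le_iff₀ hℓ]
  nlinarith [abs_nonneg c', Real.pi_pos]

/-- `|θ| ≤ 700` where `θ = α log P₄` (crude: `θ = π + O(1/𝓛)`). [cite: Zhang2022LandauSiegel, §6 p. 12] -/
theorem abs_alpha_mul_log_P4_le {D : ℕ} (hL : 3 ≤ ell D) : |alpha D * Real.log (P4 D)| ≤ 700 := by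
  have h := abs_alpha_mul_log_P4_sub_pi_le hL
  have hℓ : 0 < ell D := by linarith
  have h3 : 521 * π / ell D ≤ 521 * π / 3 := div_le_div_of_nonneg_left (by positivity) (by norm_num) hL
  have htri : |alpha D * Real.log (P4 D)| ≤ |alpha D * Real.log (P4 D) - π| + |π| := by
    have := abs_add_le (alpha D * Real.log (P4 D) - π) π
    rwa [sub_add_cancel] at this
  rw [abs_of_pos Real.pi_pos] at htri
  nlinarith [Real.pi_lt_four, Real.pi_pos]

/-- The main-term error `A|e| + B|θ−π| + C|e||θ|` is `≤ (A|c′|π + 521Bπ + 700C|c′|π)/𝓛`.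
[cite: Zhang2022LandauSiegel, §15 p. 88] -/
theorem mainErr_le {D : ℕ} (hL : 3 ≤ ell D) (A B C : ℝ) (hA : 0 ≤ A) (hB : 0 ≤ B) (hC : 0 ≤ C) :
    A * |c' * alpha D * ell D| + B * |alpha D * Real.log (P4 D) - π| +
        C * |c' * alpha D * ell D| * |alpha D * Real.log (P4 D)| ≤
      (A * |c'| * π + B * 521 * π + C * 700 * (|c'| * π)) / ell D := by
  have hℓ : 0 < ell D := by linarith
  have h1 := abs_e_le c' hL
  have h2 := abs_alpha_mul_log_P4_sub_pi_le hL
  have h3 := abs_alpha_mul_log_P4_le hL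
  rw [le_div_iff₀ hℓ]
  have e0 : 0 ≤ |c' * alpha D * ell D| := abs_nonneg _
  have t0 : 0 ≤ |alpha D * Real.log (P4 D)| := abs_nonneg _
  have hh1 : |c' * alpha D * ell D| * ell D ≤ |c'| * π := by
    have := (le_div_iff₀ hℓ).mp h1; linarith
  have hh2 : |alpha D * Real.log (P4 D) - π| * ell D ≤ 521 * π := by
    have := (le_div_iff₀ hℓ).mp h2; linarith
  have hh3 : |c' * alpha D * ell D| * ell D * |alpha D * Real.log (P4 D)| ≤ |c'| * π * 700 :=
    mul_le_mul hh1 h3 t0 (by positivity)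
  have hexp : (A * |c' * alpha D * ell D| + B * |alpha D * Real.log (P4 D) - π| +
      C * |c' * alpha D * ell D| * |alpha D * Real.log (P4 D)|) * ell D =
      A * (|c' * alpha D * ell D| * ell D) + B * (|alpha D * Real.log (P4 D) - π| * ell D) +
        C * (|c' * alpha D * ell D| * ell D * |alpha D * Real.log (P4 D)|) := by ring
  rw [hexp]
  have i1 := mul_le_mul_of_nonneg_left hh1 hA
  have i2 := mul_le_mul_of_nonneg_left hh2 hB
  have i3 := mul_le_mul_of_nonneg_left hh3 hC
  linarith

end Thresholds

end Literature.NumberTheory.LFunctions.Zhang2022.ResidueValues
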